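import Summits.AtomisticToContinuum.Crystallization.Theorems.ExcessDecayLiouvillePhononStabilityCertGram

/-!
# Near-certificate layer V3: plain (matrix) Gram forms over a difference star (lead c2, vertex scheme)

Support file for crux `PhononStability` (stmt-AtomisticToContinuum-9333), line `contragredient-window-collapse`.

A `GramP` of layer II is used here only for its stencil (`base`, `slots`, hence the difference vectors `D`):
given a symmetric rational matrix `q` on the `3S` flat indices `3i + a` (slot `i`, component `a`), the plain Gram
form is `Σ'_k Σ_{ij} Σ_{ab} q(3i+a)(3j+b) D_i(k)_a D_j(k)_b`.  Two facts: (1) if `q` is positive semidefinite as a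
real quadratic form (the hypothesis `MatPSD`, discharged natively by `psdCheckZ` of layer V1 on a scaled integer
copy), the Gram form is nonnegative; (2) the Gram form is the evaluation of an explicit two-point table (the cross
tables of layer II, block by block), so that its identity with a target pair form is a finite table comparison.
-/

noncomputable section

open scoped BigOperators Classical
open Filter Set Function
open Summit.AtomisticToContinuum.Crystallization.Theorems.PhononStabilityNegative

namespace Summit.AtomisticToContinuum.Crystallization.Theorems.PhononStabilityCWC.Cert

local notation "E3" => EuclideanSpace ℝ (Fin 3)

/-- positive semidefiniteness of a rational `n × n` matrix (flat indices) as a real quadratic form -/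
def MatPSD (n : ℕ) (q : ℕ → ℕ → ℚ) : Prop := ∀ v : Fin n → ℝ, 0 ≤ ∑ I : Fin n, ∑ J : Fin n, (q I.val J.val : ℝ) * v I * v J

namespace GramP

variable (G : GramP)

/-- the flat index of (slot `i`, component `a`): `a + 3i` (the equivalence `Fin S × Fin 3 ≃ Fin (S·3)`) -/
def flatIx (i : Fin G.S) (a : Fin 3) : ℕ := (finProdFinEquiv (i, a)).val

/-- the `3 × 3` block `(i, j)` of a flat matrix -/
def blockQ (q : ℕ → ℕ → ℚ) (i j : Fin G.S) : Mat := fun a b => q (G.flatIx i a) (G.flatIx j b)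

/-- the local plain Gram form at base point `k` -/
def qLocal (q : ℕ → ℕ → ℚ) (w : Label → E3) (k : Fin 3 → ℤ) : ℝ :=
  ∑ i : Fin G.S, ∑ j : Fin G.S, bil (G.blockQ q i j) (G.D w k i) (G.D w k j)

/-- **the plain Gram form** of the flat matrix `q` over the stencil of `G` -/
def qEval (q : ℕ → ℕ → ℚ) (w : Label → E3) : ℝ := ∑' k, G.qLocal q w k

/-- the two-point table of the plain Gram form (block by block) -/
def qTable (q : ℕ → ℕ → ℚ) : TPTable :=
  (List.finRange G.S).flatMap fun i => (List.finRange G.S).flatMap fun j => G.crossTable (G.blockQ q i j) i j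

/-! ## Nonnegativity from positive semidefiniteness -/

/-- the flattened difference vector -/
def flatD (w : Label → E3) (k : Fin 3 → ℤ) (I : Fin (G.S * 3)) : ℝ :=
  G.D w k (finProdFinEquiv.symm I).1 (finProdFinEquiv.symm I).2

/-- the local form is the flat quadratic form at the flattened difference vector. [folklore] -/
theorem qLocal_eq_flat (q : ℕ → ℕ → ℚ) (w : Label → E3) (k : Fin 3 → ℤ) :
    G.qLocal q w k = ∑ I : Fin (G.S * 3), ∑ J : Fin (G.S * 3), (q I.val J.val : ℝ) * G.flatD w k I * G.flatD w k J := by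
  rw [← finProdFinEquiv.sum_comp]
  simp_rw [← finProdFinEquiv.sum_comp (fun J => (q _ J.val : ℝ) * _ * G.flatD w k J)]
  rw [Fintype.sum_prod_type]
  simp_rw [Fintype.sum_prod_type]
  unfold qLocal bil blockQ flatD flatIx
  simp only [Equiv.symm_apply_apply]
  refine Finset.sum_congr rfl fun i _ => ?_
  rw [Finset.sum_comm]

/-- **a positive semidefinite Gram matrix gives a nonnegative local form.** -/
theorem qLocal_nonneg {q : ℕ → ℕ → ℚ} (hq : MatPSD (G.S * 3) q) (w : Label → E3) (k : Fin 3 → ℤ) :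
    0 ≤ G.qLocal q w k := by
  rw [qLocal_eq_flat]
  exact hq _

/-- **THE PLAIN GRAM FORM IS NONNEGATIVE** for a positive semidefinite matrix. -/
theorem qEval_nonneg {q : ℕ → ℕ → ℚ} (hq : MatPSD (G.S * 3) q) (w : Label → E3) : 0 ≤ G.qEval q w :=
  tsum_nonneg (G.qLocal_nonneg hq w)

/-! ## The two-point expansion -/

/-- **THE PLAIN GRAM FORM IS ITS TWO-POINT TABLE** (on finitely supported fields). -/
theorem qEval_eq_table {w : Label → E3} (hw : (support w).Finite) (q : ℕ → ℕ → ℚ) :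
    G.qEval q w = tpEval (G.qTable q) w := by
  unfold qEval qTable
  rw [tpEval_flatMap]
  have hs : ∀ i j, Summable fun k : Fin 3 → ℤ => bil (G.blockQ q i j) (G.D w k i) (G.D w k j) :=
    fun i j => G.summable_cross hw _ i j
  unfold qLocal
  rw [Summable.tsum_finsetSum (fun i _ => summable_sum fun j _ => hs i j)]
  rw [← List.sum_toFinset _ (List.nodup_finRange _), List.toFinset_finRange]
  refine Finset.sum_congr rfl fun i _ => ?_
  rw [Summable.tsum_finsetSum (fun j _ => hs i j), tpEval_flatMap,
    ← List.sum_toFinset _ (List.nodup_finRange _), List.toFinset_finRange]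
  refine Finset.sum_congr rfl fun j _ => ?_
  exact G.cross_eq hw _ i j

/-- linearity of the plain Gram form in the matrix: sums. [folklore] -/
theorem qEval_add {w : Label → E3} (hw : (support w).Finite) (q r : ℕ → ℕ → ℚ) :
    G.qEval (fun I J => q I J + r I J) w = G.qEval q w + G.qEval r w := by
  have hs : ∀ (q : ℕ → ℕ → ℚ), Summable fun k => G.qLocal q w k := by
    intro q
    unfold qLocal
    exact summable_sum fun i _ => summable_sum fun j _ => G.summable_cross hw _ i j
  unfold qEval
  rw [← (hs q).tsum_add (hs r)]
  refine tsum_congr fun k => ?_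
  unfold qLocal
  rw [← Finset.sum_add_distrib]
  refine Finset.sum_congr rfl fun i _ => ?_
  rw [← Finset.sum_add_distrib]
  refine Finset.sum_congr rfl fun j _ => ?_
  unfold bil blockQ
  rw [← Finset.sum_add_distrib]
  refine Finset.sum_congr rfl fun a _ => ?_
  rw [← Finset.sum_add_distrib]
  refine Finset.sum_congr rfl fun b _ => ?_
  push_cast; ring

/-- Anchor of this support file (registered stub of the line skeleton, lead c2): blocks of the zero matrix. -/
theorem stub_certGramQ : ∀ (G : GramP) (i j : Fin G.S), G.blockQ (fun _ _ => 0) i j = fun _ _ => 0 :=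
  fun _ _ _ => rfl

end GramP

end Summit.AtomisticToContinuum.Crystallization.Theorems.PhononStabilityCWC.Cert

end
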